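import Literature.Algebra.Homology.GroupCohomologyCoresolutionFinite
import HarnessLib

/-!
# Finite group cohomology from an exact cochain coresolution (exact-sequence form)

Topic `Algebra/Homology`; namespace `Literature.Algebra.Homology`.  Theorems only (no definition,
no named fact, no instance, no `sorry`); sequel of `GroupCohomologyCoresolutionFinite`.

`finite_groupCohomology_of_coresolution` (the finiteness half of Brown's criterion by dimension
shifting, [Brown1982CohomologyGroups, VII (7.10), III §7]) takes the coresolution already cut
into short exact pieces.  Here it is repackaged for the form in which coresolutions arise: an
EXACT SEQUENCE of representations

`0 → A —ε→ W 0 —d₀→ W 1 —d₁→ W 2 → ⋯`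

(`ε` injective, `im ε = ker d₀`, `im d_a = ker d_{a+1}`), e.g. the Čech / cellular cochain
coresolution `0 → M → Fun(X₀, M) → Fun(X₁, M) → ⋯` of an acyclic `G`-complex.  If every
`Hᵇ(G, W a)` is finite then every `Hᵇ(G, A)` is finite
(`finite_groupCohomology_of_exact_sequence`): the pieces are `Z a = ker d_a ≤ W a`
(Mathlib `Rep.subrepresentation`) with `W a ↠ Z (a+1)` the corestriction of `d_a`, and `A ≅ Z 0`.

## References

* K. S. Brown, *Cohomology of Groups*, GTM 87 (1982), III §7, VII (7.10)
  [Brown1982CohomologyGroups].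
-/

noncomputable section

namespace Literature.Algebra.Homology

open CategoryTheory groupCohomology

universe u

variable {k G : Type u} [CommRing k] [Group G]

/-- The kernel of a morphism of representations is stable under the group. [folklore] -/
theorem ker_le_comap_of_hom {X Y : Rep k G} (f : X ⟶ Y) (g : G) :
    LinearMap.ker f.hom.toLinearMap ≤ (LinearMap.ker f.hom.toLinearMap).comap (X.ρ g) := by
  intro x hx
  rw [Submodule.mem_comap, LinearMap.mem_ker, Representation.IntertwiningMap.toLinearMap_apply,
    Rep.hom_comm_apply]
  rw [LinearMap.mem_ker, Representation.IntertwiningMap.toLinearMap_apply] at hx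
  rw [hx, map_zero]

/-- A short complex of representations `X₁ → X₂ → X₃` with `f` injective, `g` surjective and
`im f = ker g` on underlying functions is short exact in `Rep k G`. [folklore] -/
theorem shortExact_of_function_exact (X : ShortComplex (Rep k G))
    (hf : Function.Injective X.f.hom) (hg : Function.Surjective X.g.hom)
    (hfg : Function.Exact X.f.hom X.g.hom) : X.ShortExact where
  exact := (forget₂ (Rep k G) (ModuleCat k)).reflects_exact_of_faithful _ <|
    (ShortComplex.moduleCat_exact_iff _).2 fun x hx => (hfg x).1 hx
  mono_f := (Rep.mono_iff_injective _).2 hf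
  epi_g := (Rep.epi_iff_surjective _).2 hg

/-- **Finite group cohomology from an exact coresolution.**  Let
`0 → A —ε→ W 0 —d₀→ W 1 —d₁→ ⋯` be an exact sequence in `Rep k G` (`ε` injective, `im ε = ker d₀`,
`im d_a = ker d_{a+1}`).  If `Hᵇ(G, W a)` is finite for all `a, b`, then `Hᵇ(G, A)` is finite for
all `b` (cut into `0 → ker d_a → W a → ker d_{a+1} → 0` and apply
`finite_groupCohomology_of_coresolution`; `A ≅ ker d₀`).
[cite: Brown1982CohomologyGroups, VII (7.10); III §7] -/
theorem finite_groupCohomology_of_exact_sequence (A : Rep k G) (W : ℕ → Rep k G)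
    (ε : A ⟶ W 0) (d : ∀ a, W a ⟶ W (a + 1))
    (hε : Function.Injective ε.hom) (h₀ : Function.Exact ε.hom (d 0).hom)
    (hd : ∀ a, Function.Exact (d a).hom (d (a + 1)).hom)
    (hW : ∀ a b, Finite (groupCohomology (W a) b)) (b : ℕ) :
    Finite (groupCohomology A b) := by
  -- the kernels `Z a = ker d_a` as subrepresentations
  let K : ∀ a, Submodule k (W a) := fun a => LinearMap.ker (d a).hom.toLinearMap
  have hK : ∀ a g, K a ≤ (K a).comap ((W a).ρ g) := fun a g => ker_le_comap_of_hom (d a) g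
  let Z : ℕ → Rep k G := fun a => Rep.subrepresentation (W a) (K a) (hK a)
  let ι : ∀ a, Z a ⟶ W a := fun a => Rep.subtype (W a) (K a) (hK a)
  have hdd : ∀ a (x : W a), (d (a + 1)).hom ((d a).hom x) = 0 := fun a x =>
    (hd a ((d a).hom x)).2 ⟨x, rfl⟩
  -- the corestrictions `W a ↠ Z (a+1)` of `d_a`
  let π : ∀ a, W a ⟶ Z (a + 1) := fun a =>
    Rep.ofHom
      { toLinearMap := LinearMap.codRestrict (K (a + 1)) (d a).hom.toLinearMap fun x => by
          change (d (a + 1)).hom ((d a).hom x) = 0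
          exact hdd a x
        isIntertwining' := fun g => by
          refine LinearMap.ext fun x => Subtype.ext ?_
          exact Rep.hom_comm_apply (d a) g x }
  have hπ : ∀ a (x : W a), ((π a).hom x : W (a + 1)) = (d a).hom x := fun a x => rfl
  have w : ∀ a, ι a ≫ π a = 0 := fun a => by
    refine Rep.hom_ext (Representation.IntertwiningMap.ext (LinearMap.ext fun x => ?_))
    apply Subtype.ext
    change (d a).hom ((ι a).hom x) = 0
    exact x.2
  have hex : ∀ a, (ShortComplex.mk (ι a) (π a) (w a)).ShortExact := fun a => by
    refine shortExact_of_function_exact _ ?_ ?_ ?_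
    · exact Subtype.val_injective
    · intro y
      obtain ⟨x, hx⟩ := (hd a (y : W (a + 1))).1 y.2
      exact ⟨x, Subtype.ext hx⟩
    · intro x
      change (π a).hom x = 0 ↔ x ∈ Set.range (ι a).hom
      constructor
      · intro hx
        have hx' : (d a).hom x = 0 := by rw [← hπ, hx]; rfl
        exact ⟨⟨x, hx'⟩, rfl⟩
      · rintro ⟨z, rfl⟩
        exact Subtype.ext z.2
  have hZ : Finite (groupCohomology (Z 0) b) :=
    finite_groupCohomology_of_coresolution_zero Z W ι π w hex hW b
  -- `A ≅ Z 0`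
  let φ : A ⟶ Z 0 :=
    Rep.ofHom
      { toLinearMap := LinearMap.codRestrict (K 0) ε.hom.toLinearMap fun x => by
          change (d 0).hom (ε.hom x) = 0
          exact (h₀ (ε.hom x)).2 ⟨x, rfl⟩
        isIntertwining' := fun g => by
          refine LinearMap.ext fun x => Subtype.ext ?_
          exact Rep.hom_comm_apply ε g x }
  have hφ : Function.Bijective φ.hom := by
    constructor
    · intro x y hxy
      exact hε (congrArg Subtype.val hxy)
    · intro z
      obtain ⟨x, hx⟩ := (h₀ (z : W 0)).1 z.2
      exact ⟨x, Subtype.ext hx⟩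
  haveI : IsIso ((forget (Rep k G)).map φ) := (isIso_iff_bijective _).2 hφ
  haveI : IsIso φ := isIso_of_reflects_iso φ (forget (Rep k G))
  exact Finite.of_equiv (groupCohomology (Z 0) b)
    ((groupCohomology.functor k G b).mapIso (asIso φ)).toLinearEquiv.toEquiv.symm

end Literature.Algebra.Homology
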